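import Mathlib
import HarnessLib
import Literature.Analysis.FluidPDE.Tao2016AveragedNS.LocalCascadeSolutions
import Literature.Analysis.FluidPDE.Tao2016AveragedNS.RenormalisedCascadeWaves
import Literature.Analysis.FluidPDE.Tao2016AveragedNS.SelfSimilarCascadeBlowup
import Literature.Analysis.FluidPDE.Tao2016AveragedNS.ViscousEternalSolutions
import Literature.Analysis.FluidPDE.Tao2016AveragedNS.BoundedEternalSolutions
import Summits.NavierStokesRegularity.NavierStokesRegularity.Theses.TaoLadderRungTwoBreak
import Summits.NavierStokesRegularity.NavierStokesRegularity.Theorems.TaoLadderRungTwoBreakNoSurvivingEternalViscBddOneSmallActionRung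
import Summits.NavierStokesRegularity.NavierStokesRegularity.Theorems.TaoLadderRungTwoBreakNoSurvivingEternalViscBddOneWeightedGrowth

/-!
# Crux K1ᵛ(1) `TaoLadderRungTwoBreak.NoSurvivingEternalViscBddOne` ⟨20419⟩ — the UNIFORM ENERGY BOUND and LATE FLUX STARVATION
# for uniformly bounded admissible eternal solutions (any covariant viscosity `ν̂ ≥ 0`) of a cancelling table

MODEL lattice ODEs only (Tao 2016 §4, §6.4; cell vocabulary `IsEternalVisc`, `UniformBound`, `physEnergy`, `physFlux`); nothing
here is a statement about the Navier–Stokes equations; no stub, crux or summit is closed (`--supports stmt-NavierStokesRegularity-20419`).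
This is the first half of the `1/ε₀` AMPLITUDE FLOOR OF BOUNDED SURVIVORS (second half: `…SurvivorAmplitudeFloor`).

Write `E_n = physEnergy`, `F_n = physFlux`, `Λ = bigLam ε₀`, `C_A = fluxConst α`, `‖W‖ ≤ B`.
* `abs_physFlux_le_energy` — the bond flux in energy form `|F_k| ≤ 2C_AΛᵏe^{−s}√E_{k+1}·E_k`.
* `energySum_le` / **`exists_uniform_physEnergy_le`** — THE UNIFORM ENERGY BOUND `sup_{n ≥ 0, σ} E_n(σ) =: K < ∞`: the block of
  shells `0 … N` is fed only through the bond `−1 → 0`, whose flux `|F₋₁| ≤ 2C_AΛ⁻¹e^{−σ}√E₀·E₋₁` is INTEGRABLE forward; the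
  interior fluxes telescope, the dissipation has a sign, the top leak is sent to `N → ∞` (one constant for EVERY shell `n ≥ 0`
  and EVERY log-time — the per-shell bounds `exists_physEnergy_le` of the tree are not uniform in the shell).
* **`physEnergy_late_le`** — LATE FLUX STARVATION: `E_n(σ₂) ≤ E_n(σ₁) + 4C_AΛⁿK^{3/2}e^{−σ₁}` for `σ₁ ≤ σ₂`, `n ≥ 1`: in log-time
  both bond fluxes of shell `n` are `≤ 2C_AΛⁿK^{3/2}e^{−σ}` (physical time `t⋆ − t = e^{−σ}` runs out), so a shell cannot GAIN
  energy late.  This is the ingredient that lets the growth law (`…WeightedGrowth`) bite on survivors with FREE timing.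
HONEST LABEL: a-priori estimates; (ρ0), (ρ+), ⟨20419⟩ and every NS statement remain OPEN; rung 0.
-/

noncomputable section

-- the summit and its single sub-problem share the name (CONVENTIONS §1)
set_option linter.dupNamespace false

namespace Summit.NavierStokesRegularity.NavierStokesRegularity.Theorems.NoSurvivingEternalViscBddOne.SurvivorEnergyBound

open Set Filter Topology MeasureTheory
open scoped RealInnerProductSpace
open Literature.Analysis.FluidPDE Literature.Analysis.FluidPDE.TaoCascade
open Summit.NavierStokesRegularity.NavierStokesRegularity.Theses.TaoLadderRungTwoBreak
open Summit.NavierStokesRegularity.NavierStokesRegularity.Theorems.NoSurvivingEternalViscBddOne.SmallAction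
open Summit.NavierStokesRegularity.NavierStokesRegularity.Theorems.NoSurvivingEternalViscBddOne.WeightedGrowth

variable {m : ℕ} {ε₀ νh : ℝ} {α : Fin m → Fin m → Fin m → ℤ × ℤ × ℤ → ℝ} {W : ℤ → ℝ → Em m}

/-! ## §1 Flux in energy form and the uniform energy bound -/

/-- The bond flux in energy form: `|F_k(s)| ≤ 2C_A Λᵏ e^{−s} √(E_{k+1}(s)) · E_k(s)` (`‖W_{k+1}‖ = Λ^{k+1}e^{−s}√E_{k+1}`).
[cite: Tao2016AveragedNS, §4 Lemma 4.1 (4.8)–(4.10) with (4.3), §6.4; tree `abs_physFlux_le`, `norm_eq_sqrt_physEnergy`] -/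
theorem abs_physFlux_le_energy (hε : 0 < ε₀) (hc : IsCancellingCoeff α) (W : ℤ → ℝ → Em m) (k : ℤ) (s : ℝ) :
    |physFlux ε₀ α W k s| ≤ 2 * fluxConst α * bigLam ε₀ ^ k * Real.exp (-s)
      * Real.sqrt (physEnergy ε₀ W (k + 1) s) * physEnergy ε₀ W k s := by
  have h := abs_physFlux_le hε hc W k s
  rw [norm_eq_sqrt_physEnergy hε W (k + 1) s] at h
  have hΛ : bigLam ε₀ ≠ 0 := (bigLam_pos (by linarith)).ne'
  have e : (bigLam ε₀)⁻¹ * bigLam ε₀ ^ (k + 1) = bigLam ε₀ ^ k := by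
    rw [zpow_add_one₀ hΛ]; field_simp
  calc |physFlux ε₀ α W k s|
      ≤ 2 * fluxConst α * (bigLam ε₀)⁻¹
          * (bigLam ε₀ ^ (k + 1) * Real.exp (-s) * Real.sqrt (physEnergy ε₀ W (k + 1) s))
          * physEnergy ε₀ W k s := h
    _ = 2 * fluxConst α * ((bigLam ε₀)⁻¹ * bigLam ε₀ ^ (k + 1)) * Real.exp (-s)
          * Real.sqrt (physEnergy ε₀ W (k + 1) s) * physEnergy ε₀ W k s := by ring
    _ = _ := by rw [e]

/-- `d/dx e^{-x} = -e^{-x}`. [folklore] -/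
private theorem hasDerivAt_exp_neg' (x : ℝ) :
    HasDerivAt (fun y : ℝ => Real.exp (-y)) (-Real.exp (-x)) x := by
  have h := (hasDerivAt_neg' x).exp
  simpa using h

/-- **Energy balance of the shells `0 … N` with an integrable feed.**  For an admissible eternal solution (any `ν̂ ≥ 0`) of a
cancelling table with `‖W‖ ≤ B`, `E₋₁ ≤ A₁`, `E₀ ≤ A₀` at all log-times, and `σ₀ ≤ σ`:
`Σ_{i≤N} E_i(σ) ≤ B²e^{2σ₀}/(1 − Λ⁻²) + 2C_AΛ⁻¹√A₀·A₁·e^{−σ₀}` (uniformly in `N` and `σ`): the only feed of the block is the bond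
`−1 → 0`, whose flux is `≤ 2C_AΛ⁻¹e^{−s}√A₀A₁`; the dissipation has a sign; the top leak vanishes as the block grows.
[cite: Tao2016AveragedNS, §4 Lemma 4.1 (4.8)–(4.10) with (4.3), the viscous equation before Thm. 4.2, §6.4; tree `hasDerivAt_weightedSum`] -/
theorem energySum_le (hε : 0 < ε₀) (hW : IsEternalVisc ε₀ νh α W) (hc : IsCancellingCoeff α)
    {B : ℝ} (hB : ∀ k σ, ‖W k σ‖ ≤ B) {A₁ A₀ : ℝ}
    (hA₁ : ∀ σ, physEnergy ε₀ W (-1) σ ≤ A₁) (hA₀ : ∀ σ, physEnergy ε₀ W 0 σ ≤ A₀)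
    (N : ℕ) {σ₀ σ : ℝ} (hle : σ₀ ≤ σ) :
    ∑ i ∈ Finset.range (N + 1), physEnergy ε₀ W i σ
      ≤ B ^ 2 * Real.exp (2 * σ₀) / (1 - (bigLam ε₀ ^ 2)⁻¹)
        + 2 * fluxConst α * (bigLam ε₀)⁻¹ * Real.sqrt A₀ * A₁ * Real.exp (-σ₀) := by
  have hΛ : 0 < bigLam ε₀ := bigLam_pos (by linarith)
  have hΛ1 : 1 < bigLam ε₀ := by unfold bigLam; exact Real.one_lt_rpow (by linarith) (by norm_num)
  have hB0 : 0 ≤ B := (norm_nonneg _).trans (hB 0 0)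
  have hC0 := fluxConst_nonneg α
  have hA₁0 : 0 ≤ A₁ := (physEnergy_nonneg ε₀ W (-1) 0).trans (hA₁ 0)
  have hA₀0 : 0 ≤ A₀ := (physEnergy_nonneg ε₀ W 0 0).trans (hA₀ 0)
  set q : ℝ := (bigLam ε₀ ^ 2)⁻¹ with hq
  have hq0 : 0 ≤ q := by positivity
  have hq1 : q < 1 := inv_lt_one_of_one_lt₀ (by nlinarith)
  set φ : ℝ := 2 * fluxConst α * (bigLam ε₀)⁻¹ * Real.sqrt A₀ * A₁ with hφ
  have hφ0 : 0 ≤ φ := by positivity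
  set δ₀ : ℝ := B ^ 2 * Real.exp (2 * σ₀) / (1 - q) with hδ₀
  have hsplit : ∀ i : ℕ, (bigLam ε₀ ^ (i : ℤ))⁻¹ ^ 2 = q ^ i := fun i => by
    rw [zpow_natCast, hq, inv_pow, inv_pow, ← pow_mul, ← pow_mul, mul_comm]
  -- the feed through the bond `-1 → 0`
  have hfeed : ∀ s, |physFlux ε₀ α W (-1) s| ≤ φ * Real.exp (-s) := by
    intro s
    have h := abs_physFlux_le_energy hε hc W (-1) s
    have e1 : (-1 : ℤ) + 1 = 0 := by norm_num
    rw [e1, zpow_neg_one] at h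
    have hs : Real.sqrt (physEnergy ε₀ W 0 s) ≤ Real.sqrt A₀ := Real.sqrt_le_sqrt (hA₀ s)
    have h2 : 2 * fluxConst α * (bigLam ε₀)⁻¹ * Real.exp (-s) * Real.sqrt (physEnergy ε₀ W 0 s)
        * physEnergy ε₀ W (-1) s ≤ 2 * fluxConst α * (bigLam ε₀)⁻¹ * Real.exp (-s) * Real.sqrt A₀ * A₁ := by
      have hx : 0 ≤ 2 * fluxConst α * (bigLam ε₀)⁻¹ * Real.exp (-s) := by positivity
      exact mul_le_mul (mul_le_mul_of_nonneg_left hs hx) (hA₁ s) (physEnergy_nonneg _ _ _ _) (by positivity)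
    calc |physFlux ε₀ α W (-1) s| ≤ _ := h
      _ ≤ _ := h2
      _ = φ * Real.exp (-s) := by rw [hφ]; ring
  -- the balance for the block `0 … N'`, any `N'` (top leak kept explicit)
  have hblock : ∀ N' : ℕ, ∑ i ∈ Finset.range (N' + 1), physEnergy ε₀ W i σ
      ≤ δ₀ + φ * Real.exp (-σ₀)
        + (2 * fluxConst α * (bigLam ε₀)⁻¹ * B ^ 3 * Real.exp (2 * σ) * (σ - σ₀)) * q ^ N' := by
    intro N'
    set L : ℝ := 2 * fluxConst α * (bigLam ε₀)⁻¹ * B ^ 3 * q ^ N' with hL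
    have hL0 : 0 ≤ L := by positivity
    set f : ℝ → ℝ := fun x => ∑ i ∈ Finset.range (N' + 1), physEnergy ε₀ W i x with hf
    set f' : ℝ → ℝ := fun s => physFlux ε₀ α W (-1) s
        + (1 - 1) * ∑ i ∈ Finset.range N', (1 : ℝ) ^ i * physFlux ε₀ α W i s
        - (1 : ℝ) ^ N' * physFlux ε₀ α W N' s
        - ∑ i ∈ Finset.range (N' + 1), (1 : ℝ) ^ i * (2 * viscCoef ε₀ νh i s * physEnergy ε₀ W i s) with hf'
    have hderiv : ∀ s, HasDerivAt f (f' s) s := by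
      intro s
      have h := hasDerivAt_weightedSum hε hW hc 1 N' s
      have hfun : (fun x => ∑ i ∈ Finset.range (N' + 1), (1 : ℝ) ^ i * physEnergy ε₀ W i x) = f := by
        funext x; simp [hf]
      rw [hfun] at h
      exact h
    -- the top leak
    have hleak : ∀ s, s ≤ σ → |physFlux ε₀ α W N' s| ≤ L * Real.exp (2 * σ) := by
      intro s hs
      have h1 := abs_physFlux_le hε hc W N' s
      have h2 : physEnergy ε₀ W N' s ≤ (bigLam ε₀ ^ (N' : ℤ))⁻¹ ^ 2 * B ^ 2 * Real.exp (2 * σ) :=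
        (physEnergy_le_exp hε hB (N' : ℤ) s).trans
          (mul_le_mul_of_nonneg_left (Real.exp_le_exp.2 (by linarith)) (by positivity))
      rw [hsplit N'] at h2
      have hx : 0 ≤ 2 * fluxConst α * (bigLam ε₀)⁻¹ := by positivity
      calc |physFlux ε₀ α W N' s|
          ≤ 2 * fluxConst α * (bigLam ε₀)⁻¹ * ‖W ((N' : ℤ) + 1) s‖ * physEnergy ε₀ W N' s := h1
        _ ≤ 2 * fluxConst α * (bigLam ε₀)⁻¹ * B * (q ^ N' * B ^ 2 * Real.exp (2 * σ)) :=
            mul_le_mul (mul_le_mul_of_nonneg_left (hB _ _) hx) h2 (physEnergy_nonneg _ _ _ _) (by positivity)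
        _ = L * Real.exp (2 * σ) := by rw [hL]; ring
    have hf'le : ∀ s, s ≤ σ → f' s ≤ φ * Real.exp (-s) + L * Real.exp (2 * σ) := by
      intro s hs
      have h1 : physFlux ε₀ α W (-1) s ≤ φ * Real.exp (-s) := (le_abs_self _).trans (hfeed s)
      have h2 : -((1 : ℝ) ^ N' * physFlux ε₀ α W N' s) ≤ L * Real.exp (2 * σ) := by
        rw [one_pow, one_mul]; exact (neg_le_abs _).trans (hleak s hs)
      have h3 : 0 ≤ ∑ i ∈ Finset.range (N' + 1), (1 : ℝ) ^ i * (2 * viscCoef ε₀ νh i s * physEnergy ε₀ W i s) :=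
        Finset.sum_nonneg fun i _ => mul_nonneg (by positivity)
          (mul_nonneg (mul_nonneg two_pos.le (viscCoef_nonneg hε hW.nonneg _ _)) (physEnergy_nonneg ε₀ W _ s))
      simp only [hf']
      linarith
    -- `g = f + φ e^{-x} - (L e^{2σ}) x` is antitone on `[σ₀, σ]`
    set g : ℝ → ℝ := fun x => f x + φ * Real.exp (-x) - L * Real.exp (2 * σ) * x with hg
    have hdg : ∀ x, HasDerivAt g (f' x - φ * Real.exp (-x) - L * Real.exp (2 * σ)) x := by
      intro x
      rw [hg]
      have h1 := ((hderiv x).fun_add ((hasDerivAt_exp_neg' x).const_mul φ)).fun_sub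
        ((hasDerivAt_id' x).const_mul (L * Real.exp (2 * σ)))
      exact h1.congr_deriv (by ring)
    have hg_anti : AntitoneOn g (Icc σ₀ σ) := by
      refine antitoneOn_of_deriv_nonpos (convex_Icc σ₀ σ)
        (fun x _ => (hdg x).continuousAt.continuousWithinAt)
        (fun x _ => (hdg x).differentiableAt.differentiableWithinAt) ?_
      intro x hx
      rw [interior_Icc] at hx
      rw [(hdg x).deriv]
      have := hf'le x hx.2.le
      linarith
    have hgle : g σ ≤ g σ₀ := hg_anti ⟨le_rfl, hle⟩ ⟨hle, le_rfl⟩ hle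
    -- the initial block energy is a geometric sum
    have hinit : f σ₀ ≤ δ₀ := by
      have hterm : ∀ i ∈ Finset.range (N' + 1), physEnergy ε₀ W i σ₀ ≤ B ^ 2 * Real.exp (2 * σ₀) * q ^ i := by
        intro i _
        rw [← hsplit i]
        have h := physEnergy_le_exp hε hB (i : ℤ) σ₀
        linarith
      refine (Finset.sum_le_sum hterm).trans ?_
      rw [← Finset.mul_sum, hδ₀, div_eq_mul_one_div]
      have hgeom := geom_sum_Ico_le_of_lt_one hq0 hq1 (m := 0) (n := N' + 1)
      rw [pow_zero, ← Finset.range_eq_Ico] at hgeom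
      exact mul_le_mul_of_nonneg_left hgeom (by positivity)
    have hex : 0 ≤ φ * Real.exp (-σ) := mul_nonneg hφ0 (Real.exp_pos _).le
    have hmain : f σ ≤ δ₀ + φ * Real.exp (-σ₀) + L * Real.exp (2 * σ) * (σ - σ₀) := by
      have h1 : f σ + φ * Real.exp (-σ) - L * Real.exp (2 * σ) * σ
          ≤ f σ₀ + φ * Real.exp (-σ₀) - L * Real.exp (2 * σ) * σ₀ := hgle
      linarith
    calc f σ ≤ δ₀ + φ * Real.exp (-σ₀) + L * Real.exp (2 * σ) * (σ - σ₀) := hmain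
      _ = δ₀ + φ * Real.exp (-σ₀)
          + (2 * fluxConst α * (bigLam ε₀)⁻¹ * B ^ 3 * Real.exp (2 * σ) * (σ - σ₀)) * q ^ N' := by
        rw [hL]; ring
  -- let `N' → ∞`
  have hN' : ∀ N' : ℕ, N ≤ N' → ∑ i ∈ Finset.range (N + 1), physEnergy ε₀ W i σ
      ≤ δ₀ + φ * Real.exp (-σ₀)
        + (2 * fluxConst α * (bigLam ε₀)⁻¹ * B ^ 3 * Real.exp (2 * σ) * (σ - σ₀)) * q ^ N' := by
    intro N' hNN'
    have hsub : ∑ i ∈ Finset.range (N + 1), physEnergy ε₀ W i σ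
        ≤ ∑ i ∈ Finset.range (N' + 1), physEnergy ε₀ W i σ :=
      Finset.sum_le_sum_of_subset_of_nonneg (Finset.range_mono (by omega))
        fun i _ _ => physEnergy_nonneg ε₀ W _ σ
    exact hsub.trans (hblock N')
  have hg : Continuous fun t : ℝ => δ₀ + φ * Real.exp (-σ₀)
      + (2 * fluxConst α * (bigLam ε₀)⁻¹ * B ^ 3 * Real.exp (2 * σ) * (σ - σ₀)) * t := by
    fun_prop
  have hlim := (hg.tendsto 0).comp (tendsto_pow_atTop_nhds_zero_of_lt_one hq0 hq1)
  have hmain := ge_of_tendsto hlim ((eventually_ge_atTop N).mono fun N' hNN' => hN' N' hNN')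
  simpa only [mul_zero, add_zero, hδ₀, hφ] using hmain

/-- **THE UNIFORM ENERGY BOUND.**  A uniformly bounded admissible eternal solution (any `ν̂ ≥ 0`) of a cancelling table has
`sup_{n ≥ 0, σ} E_n(σ) < ∞`: one constant `K > 0` bounds the physical energy of EVERY shell `n ≥ 0` at EVERY log-time.
[cite: Tao2016AveragedNS, §4 Lemma 4.1 (4.8)–(4.10) with (4.3), the viscous equation before Thm. 4.2, §6.4; this file] -/
theorem exists_uniform_physEnergy_le (hε : 0 < ε₀) (hW : IsEternalVisc ε₀ νh α W) (hc : IsCancellingCoeff α)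
    (hU : UniformBound W) :
    ∃ K : ℝ, 0 < K ∧ ∀ (n : ℕ) (σ : ℝ), physEnergy ε₀ W n σ ≤ K := by
  obtain ⟨B, hB⟩ := hU
  obtain ⟨A₁, hA₁⟩ := exists_physEnergy_le hε hW ⟨B, hB⟩ (-1)
  obtain ⟨A₀, hA₀⟩ := exists_physEnergy_le hε hW ⟨B, hB⟩ 0
  have hΛ : 0 < bigLam ε₀ := bigLam_pos (by linarith)
  have hΛ1 : 1 < bigLam ε₀ := by unfold bigLam; exact Real.one_lt_rpow (by linarith) (by norm_num)
  have hB0 : 0 ≤ B := (norm_nonneg _).trans (hB 0 0)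
  have hC0 := fluxConst_nonneg α
  have hA₁0 : 0 ≤ A₁ := (physEnergy_nonneg ε₀ W (-1) 0).trans (hA₁ 0)
  have hq1 : (bigLam ε₀ ^ 2)⁻¹ < 1 := inv_lt_one_of_one_lt₀ (by nlinarith)
  have h1q : 0 < 1 - (bigLam ε₀ ^ 2)⁻¹ := by linarith
  have hq0 : 0 ≤ (bigLam ε₀ ^ 2)⁻¹ := by positivity
  set K₀ : ℝ := B ^ 2 / (1 - (bigLam ε₀ ^ 2)⁻¹)
    + 2 * fluxConst α * (bigLam ε₀)⁻¹ * Real.sqrt A₀ * A₁ with hK₀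
  have hK₀0 : 0 ≤ K₀ := by positivity
  refine ⟨K₀ + 1, by linarith, fun n σ => ?_⟩
  rcases le_or_gt 0 σ with hσ | hσ
  · -- late: the block balance from `σ₀ = 0`
    have h := energySum_le hε hW hc hB hA₁ hA₀ n hσ
    simp only [mul_zero, neg_zero, Real.exp_zero, mul_one] at h
    have hsingle : physEnergy ε₀ W n σ ≤ ∑ i ∈ Finset.range (n + 1), physEnergy ε₀ W i σ :=
      Finset.single_le_sum (f := fun i : ℕ => physEnergy ε₀ W i σ) (fun i _ => physEnergy_nonneg ε₀ W _ _)
        (Finset.mem_range.2 (Nat.lt_succ_self n))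
    have := hsingle.trans h
    rw [hK₀]; linarith
  · -- early: the crude bound `E_n(σ) ≤ Λ^{-2n} B² e^{2σ} ≤ B²`
    have h := physEnergy_le_exp hε hB (n : ℤ) σ
    have h1 : (bigLam ε₀ ^ (n : ℤ))⁻¹ ^ 2 ≤ 1 := by
      have h1' : 1 ≤ bigLam ε₀ ^ (n : ℤ) := one_le_zpow₀ hΛ1.le (by positivity)
      have h2' : (bigLam ε₀ ^ (n : ℤ))⁻¹ ≤ 1 := inv_le_one_of_one_le₀ h1'
      have h3' : 0 ≤ (bigLam ε₀ ^ (n : ℤ))⁻¹ := inv_nonneg.mpr (zero_le_one.trans h1')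
      calc (bigLam ε₀ ^ (n : ℤ))⁻¹ ^ 2 ≤ 1 ^ 2 := pow_le_pow_left₀ h3' h2' 2
        _ = 1 := one_pow 2
    have h2 : Real.exp (2 * σ) ≤ 1 := by
      rw [← Real.exp_zero]; exact Real.exp_le_exp.2 (by linarith)
    have h3 : physEnergy ε₀ W n σ ≤ B ^ 2 := by
      calc physEnergy ε₀ W n σ ≤ (bigLam ε₀ ^ (n : ℤ))⁻¹ ^ 2 * B ^ 2 * Real.exp (2 * σ) := h
        _ ≤ 1 * B ^ 2 * 1 := by
          exact mul_le_mul (mul_le_mul_of_nonneg_right h1 (by positivity)) h2 (Real.exp_pos _).le (by positivity)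
        _ = B ^ 2 := by ring
    have h4 : B ^ 2 ≤ B ^ 2 / (1 - (bigLam ε₀ ^ 2)⁻¹) := by
      rw [le_div_iff₀ h1q]
      nlinarith [mul_nonneg (sq_nonneg B) hq0]
    have h5 : 0 ≤ 2 * fluxConst α * (bigLam ε₀)⁻¹ * Real.sqrt A₀ * A₁ := by positivity
    rw [hK₀]; linarith

/-! ## §2 Late flux starvation -/

/-- **LATE FLUX STARVATION.**  With the uniform energy bound `E_k ≤ K` on all shells `k ≥ 0`, a shell `n ≥ 1` of an admissible
eternal solution (any `ν̂ ≥ 0`) of a cancelling table cannot gain energy late: for `σ₁ ≤ σ₂`,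
`E_n(σ₂) ≤ E_n(σ₁) + 4C_AΛⁿK^{3/2}e^{−σ₁}` — both bond fluxes are `≤ 2C_AΛⁿK^{3/2}e^{−σ}` and the dissipation has a sign
(in physical time `t⋆ − t = e^{−σ}` runs out).
[cite: Tao2016AveragedNS, §4 Lemma 4.1 (4.8)–(4.10) with (4.3), the viscous equation before Thm. 4.2, §6.4; this file] -/
theorem physEnergy_late_le (hε : 0 < ε₀) (hW : IsEternalVisc ε₀ νh α W) (hc : IsCancellingCoeff α)
    {K : ℝ} (hK0 : 0 ≤ K) (hK : ∀ (n : ℕ) (σ : ℝ), physEnergy ε₀ W n σ ≤ K) {n : ℕ} (hn : 1 ≤ n)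
    {σ₁ σ₂ : ℝ} (h12 : σ₁ ≤ σ₂) :
    physEnergy ε₀ W n σ₂ ≤ physEnergy ε₀ W n σ₁
      + 4 * fluxConst α * bigLam ε₀ ^ n * (K * Real.sqrt K) * Real.exp (-σ₁) := by
  have hΛ : 0 < bigLam ε₀ := bigLam_pos (by linarith)
  have hΛ1 : 1 ≤ bigLam ε₀ := one_le_bigLam hε.le
  have hC0 := fluxConst_nonneg α
  have hKK : 0 ≤ K * Real.sqrt K := by positivity
  set Cst : ℝ := 4 * fluxConst α * bigLam ε₀ ^ n * (K * Real.sqrt K) with hCst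
  have hCst0 : 0 ≤ Cst := by positivity
  -- the incoming bond `n-1 → n`
  have hin : ∀ s, |physFlux ε₀ α W ((n : ℤ) - 1) s|
      ≤ 2 * fluxConst α * bigLam ε₀ ^ n * (K * Real.sqrt K) * Real.exp (-s) := by
    intro s
    have h := abs_physFlux_le_energy hε hc W ((n : ℤ) - 1) s
    rw [sub_add_cancel] at h
    have hz : bigLam ε₀ ^ ((n : ℤ) - 1) ≤ bigLam ε₀ ^ n := by
      rw [← zpow_natCast]; exact zpow_le_zpow_right₀ hΛ1 (by omega)
    have hz0 : 0 ≤ bigLam ε₀ ^ ((n : ℤ) - 1) := (zpow_pos hΛ _).le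
    have hEn : Real.sqrt (physEnergy ε₀ W n s) ≤ Real.sqrt K := Real.sqrt_le_sqrt (hK n s)
    have hEm : physEnergy ε₀ W ((n : ℤ) - 1) s ≤ K := by
      have e : ((n : ℤ) - 1) = ((n - 1 : ℕ) : ℤ) := by omega
      rw [e]; exact hK (n - 1) s
    calc |physFlux ε₀ α W ((n : ℤ) - 1) s|
        ≤ 2 * fluxConst α * bigLam ε₀ ^ ((n : ℤ) - 1) * Real.exp (-s)
            * Real.sqrt (physEnergy ε₀ W n s) * physEnergy ε₀ W ((n : ℤ) - 1) s := h
      _ ≤ 2 * fluxConst α * bigLam ε₀ ^ n * Real.exp (-s) * Real.sqrt K * K := by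
          have h0 : 0 ≤ 2 * fluxConst α := by positivity
          have h1 : 2 * fluxConst α * bigLam ε₀ ^ ((n : ℤ) - 1) * Real.exp (-s)
              ≤ 2 * fluxConst α * bigLam ε₀ ^ n * Real.exp (-s) :=
            mul_le_mul_of_nonneg_right (mul_le_mul_of_nonneg_left hz h0) (Real.exp_pos _).le
          have h1' : 0 ≤ 2 * fluxConst α * bigLam ε₀ ^ ((n : ℤ) - 1) * Real.exp (-s) := by positivity
          exact mul_le_mul (mul_le_mul h1 hEn (Real.sqrt_nonneg _) (by positivity)) hEm
            (physEnergy_nonneg _ _ _ _) (by positivity)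
      _ = 2 * fluxConst α * bigLam ε₀ ^ n * (K * Real.sqrt K) * Real.exp (-s) := by ring
  -- the outgoing bond `n → n+1`
  have hout : ∀ s, |physFlux ε₀ α W n s|
      ≤ 2 * fluxConst α * bigLam ε₀ ^ n * (K * Real.sqrt K) * Real.exp (-s) := by
    intro s
    have h := abs_physFlux_le_energy hε hc W n s
    rw [zpow_natCast] at h
    have hEn : Real.sqrt (physEnergy ε₀ W ((n : ℤ) + 1) s) ≤ Real.sqrt K := by
      have e : ((n : ℤ) + 1) = ((n + 1 : ℕ) : ℤ) := by push_cast; ring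
      rw [e]; exact Real.sqrt_le_sqrt (hK (n + 1) s)
    have hEm : physEnergy ε₀ W n s ≤ K := hK n s
    calc |physFlux ε₀ α W n s|
        ≤ 2 * fluxConst α * bigLam ε₀ ^ n * Real.exp (-s)
            * Real.sqrt (physEnergy ε₀ W ((n : ℤ) + 1) s) * physEnergy ε₀ W n s := h
      _ ≤ 2 * fluxConst α * bigLam ε₀ ^ n * Real.exp (-s) * Real.sqrt K * K := by
          have h1' : 0 ≤ 2 * fluxConst α * bigLam ε₀ ^ n * Real.exp (-s) := by positivity
          exact mul_le_mul (mul_le_mul_of_nonneg_left hEn h1') hEm (physEnergy_nonneg _ _ _ _) (by positivity)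
      _ = 2 * fluxConst α * bigLam ε₀ ^ n * (K * Real.sqrt K) * Real.exp (-s) := by ring
  -- `g = E_n + Cst·e^{-x}` is antitone on `ℝ`
  set g : ℝ → ℝ := fun x => physEnergy ε₀ W n x + Cst * Real.exp (-x) with hg
  have hdg : ∀ x, HasDerivAt g
      (physFlux ε₀ α W ((n : ℤ) - 1) x - physFlux ε₀ α W n x
        - 2 * viscCoef ε₀ νh n x * physEnergy ε₀ W n x - Cst * Real.exp (-x)) x := by
    intro x
    rw [hg]
    have h1 := (hasDerivAt_physEnergy hε hW hc (n : ℤ) x).fun_add ((hasDerivAt_exp_neg' x).const_mul Cst)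
    exact h1.congr_deriv (by ring)
  have hg_anti : Antitone g := by
    refine antitone_of_deriv_nonpos (fun x => (hdg x).differentiableAt) fun x => ?_
    rw [(hdg x).deriv]
    have h1 : physFlux ε₀ α W ((n : ℤ) - 1) x ≤ 2 * fluxConst α * bigLam ε₀ ^ n * (K * Real.sqrt K) * Real.exp (-x) :=
      (le_abs_self _).trans (hin x)
    have h2 : -physFlux ε₀ α W n x ≤ 2 * fluxConst α * bigLam ε₀ ^ n * (K * Real.sqrt K) * Real.exp (-x) :=
      (neg_le_abs _).trans (hout x)
    have h3 : 0 ≤ 2 * viscCoef ε₀ νh n x * physEnergy ε₀ W n x :=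
      mul_nonneg (mul_nonneg two_pos.le (viscCoef_nonneg hε hW.nonneg _ _)) (physEnergy_nonneg ε₀ W _ x)
    have h4 : Cst * Real.exp (-x) = 2 * (2 * fluxConst α * bigLam ε₀ ^ n * (K * Real.sqrt K) * Real.exp (-x)) := by
      rw [hCst]; ring
    linarith
  have hmono := hg_anti h12
  simp only [hg] at hmono
  have hpos : 0 ≤ Cst * Real.exp (-σ₂) := mul_nonneg hCst0 (Real.exp_pos _).le
  linarith

end Summit.NavierStokesRegularity.NavierStokesRegularity.Theorems.NoSurvivingEternalViscBddOne.SurvivorEnergyBound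

end
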